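import Literature.NumberTheory.ComplexMultiplication.EllipticUnits.DeShalitDivisionPointsLattice
import HarnessLib

/-!
# The `𝔭̄`-division point `ū = β̄Ω − Ω/π₁` and the translates `k·u_{N+1} + ū` on the model lattice `L = Ω·𝔣`: the lattice
# side conditions of the CM descent (N1) (de Shalit II.4.4 (iv) at the conjugate prime — proofs only)

Topic `NumberTheory/ComplexMultiplication/EllipticUnits` (theorems only; no definition, no named fact, no instance).  Cell `bsd-print-cf2`,
width seat `bsd-line-cf2-p1-w5` g17, piece B9 (N1)-lat.  Companion of `DeShalitDivisionPointsLattice` (B-lat): there `u_n = ι(βⁿ)Ω − Ω/ι(π₀ⁿ)`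
(`βπ₀ ≡ 1 mod 𝔣`) are the `𝔭`-power division points of the split prime `2 = π₀π₁`; here `ū := ι(β̄)Ω − Ω/ι(π₁)` (`β̄π₁ ≡ 1 mod 𝔣`) is the
primitive `𝔭̄`-division point and `u′ = k·u_{N+1} + ū` (`k : ℕ`) are the arguments at which `Cm7Kernel.mem_kernel_of_cmDescent`
(`Cm7KernelDescent`) is fed through `DivisionPointsLaneDescent`.  Hypotheses: `Ω ≠ 0`, `π₀ + π₁ = 1` (trace `1`: `π₀, π₁` the two roots of
`T² − T + 2`, so `π₀ − 1 = −π₁` and `(π₀, π₁) = 1`), `π₁` not a unit, and `2^m ∉ 𝔣` for all `m` (`(𝔣, 2) = 1`, `𝔣 ≠ 𝒪_K`).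

* §1 `ū`: `mul_conjPt_mem` (`π₁ū ∈ L`), `two_mul_conjPt_mem` (`2ū ∈ L`), `conjPt_notMem` (`ū ∉ L`), `mul_conjPt_sub_conjPt_mem`
  (`π₀ū − ū ∈ L`), `conjPt_mem_of_pow_mul_mem` (`π₀^m ū ∈ L ⟹ ū ∈ L`);
* §2 `u′ = k·u_{N+1} + ū`: ★ `nsmul_divisionPt_add_conjPt_notMem` (`u′ ∉ L`), `mul_nsmul_divisionPt_add_conjPt_notMem` (`π₀u′ ∉ L`),
  `two_pow_mul_nsmul_divisionPt_add_conjPt_mem` (`2^{N+2}u′ ∈ L`), `base_add_…_notMem` (`Ω + u′ ∉ L`), `mul_base_add_…_notMem`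
  (`π₀(Ω + u′) ∉ L`), ★ `mul_…_add_two_mul_notMem` (the EXCLUSION `π₀u′ + 2π₀Ω ∉ L`), ★ `mul_…_sub_…_mem` (the CONGRUENCE
  `π₀(k·u_{N+2} + ū) − (k·u_{N+1} + ū) ∈ L`), `mul_nsmul_divisionPt_one_add_conjPt_sub_conjPt_mem` (`π₀(k·u₁ + ū) − ū ∈ L`),
  `two_mul_nsmul_divisionPt_one_add_conjPt_mem` (`2(k·u₁ + ū) ∈ L`).

No summit statement is proved; BSD is not proved by any of this.

## References
* [deShalit1987] E. de Shalit, *Iwasawa theory of elliptic curves with complex multiplication* (1987), II §4.2 (6), II §4.4 Definition, (iv).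
* [SilvermanAEC2009] J. H. Silverman, *The Arithmetic of Elliptic Curves*, 2nd ed. (2009), Prop. VI.3.6 (b).
-/

noncomputable section

open scoped Classical
open NumberField PeriodPair

namespace Literature.NumberTheory.ComplexMultiplication.EllipticUnits

variable {K : Type} [Field K] (ι : K →+* ℂ) {𝔣 : Ideal (𝓞 K)} {L : PeriodPair} {Ω : ℂ}
  (hL : ∀ z : ℂ, z ∈ L.lattice ↔ ∃ a ∈ 𝔣, z = Ω * ι (a : K)) {β β' π₀ π₁ : 𝓞 K}

/-! ## §1 The `𝔭̄`-division point `ū = ι(β̄)Ω − Ω/ι(π₁)` -/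

section ConjPt

include hL in
/-- `π₁·ū = Ω·ι(β̄π₁ − 1) ∈ L`: `ū` is a `𝔭̄`-division point. [cite: deShalit1987, II §4.4 (iv)] -/
theorem mul_conjPt_mem (hβ' : β' * π₁ - 1 ∈ 𝔣) (hπ₁ : π₁ ≠ 0) :
    ι (π₁ : K) * (ι (β' : K) * Ω - Ω / ι (π₁ : K)) ∈ L.lattice := by
  have h0 : ι (π₁ : K) ≠ 0 := (map_ne_zero ι).mpr (by exact_mod_cast hπ₁)
  rw [hL]
  refine ⟨β' * π₁ - 1, hβ', ?_⟩
  push_cast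
  rw [map_sub, map_mul, map_one]
  field_simp

include hL in
/-- `2ū ∈ L` when `2 = π₀π₁`. [cite: deShalit1987, II §4.4 (iv)] -/
theorem two_mul_conjPt_mem (hβ' : β' * π₁ - 1 ∈ 𝔣) (hπ₁ : π₁ ≠ 0) (h2 : (2 : 𝓞 K) = π₀ * π₁) :
    (2 : ℂ) * (ι (β' : K) * Ω - Ω / ι (π₁ : K)) ∈ L.lattice := by
  have e : (2 : ℂ) = ι (π₀ : K) * ι (π₁ : K) := by
    have := two_pow_eq_of_split ι h2 1
    simpa [mul_comm] using this
  rw [e, mul_assoc]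
  exact isCMLattice_of_model ι hL _ _ (mul_conjPt_mem ι hL hβ' hπ₁)

include hL in
/-- `ū ∉ L` (`π₁` not a unit: `ū = Ω·ι(a)` would give `π₁(β̄ − a) = 1`). [cite: deShalit1987, II §4.4 (iv)] -/
theorem conjPt_notMem (hΩ : Ω ≠ 0) (hπ₁ : π₁ ≠ 0) (hu : ¬ IsUnit π₁) :
    ι (β' : K) * Ω - Ω / ι (π₁ : K) ∉ L.lattice := by
  intro h
  have h0 : ι (π₁ : K) ≠ 0 := (map_ne_zero ι).mpr (by exact_mod_cast hπ₁)
  obtain ⟨a, -, ha⟩ := (hL _).mp h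
  have e1 : ι (π₁ : K) * (ι (β' : K) * Ω - Ω / ι (π₁ : K)) = Ω * (ι (π₁ : K) * ι (β' : K) - 1) := by
    field_simp
  rw [ha] at e1
  have e : Ω * (ι (π₁ : K) * (ι (β' : K) - ι (a : K))) = Ω * 1 := by linear_combination -e1
  have e2 := mul_left_cancel₀ hΩ e
  rw [← map_sub, ← map_mul, ← map_one ι] at e2
  have e3 : (π₁ : K) * ((β' : K) - (a : K)) = 1 := ι.injective e2
  have e4 : π₁ * (β' - a) = 1 := by exact_mod_cast e3
  exact hu (IsUnit.of_mul_eq_one _ e4)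

include hL in
/-- `π₀ū − ū = −π₁ū ∈ L` (`π₀ + π₁ = 1`). [cite: deShalit1987, II §4.4 (iv)] -/
theorem mul_conjPt_sub_conjPt_mem (htr : π₀ + π₁ = 1) (hβ' : β' * π₁ - 1 ∈ 𝔣) (hπ₁ : π₁ ≠ 0) :
    ι (π₀ : K) * (ι (β' : K) * Ω - Ω / ι (π₁ : K)) - (ι (β' : K) * Ω - Ω / ι (π₁ : K)) ∈ L.lattice := by
  have e : (π₀ : K) = 1 - (π₁ : K) := by
    have h := congrArg (fun x : 𝓞 K => (x : K)) htr
    push_cast at h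
    linear_combination h
  rw [e, map_sub, map_one, show ((1 : ℂ) - ι (π₁ : K)) * (ι (β' : K) * Ω - Ω / ι (π₁ : K)) - (ι (β' : K) * Ω - Ω / ι (π₁ : K)) =
    -(ι (π₁ : K) * (ι (β' : K) * Ω - Ω / ι (π₁ : K))) by ring]
  exact neg_mem (mul_conjPt_mem ι hL hβ' hπ₁)

include hL in
/-- `π₀^m ū ∈ L ⟹ ū ∈ L` (`(π₀^m, π₁) = 1` from `π₀ + π₁ = 1`, and `π₁ū ∈ L`). [cite: deShalit1987, II §4.4 (iv)] -/
theorem conjPt_mem_of_pow_mul_mem (htr : π₀ + π₁ = 1) (hβ' : β' * π₁ - 1 ∈ 𝔣) (hπ₁ : π₁ ≠ 0) (m : ℕ)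
    (h : ι ((π₀ ^ m : 𝓞 K) : K) * (ι (β' : K) * Ω - Ω / ι (π₁ : K)) ∈ L.lattice) :
    ι (β' : K) * Ω - Ω / ι (π₁ : K) ∈ L.lattice := by
  have hcop : IsCoprime (π₀ ^ m) π₁ := (IsCoprime.pow_left (m := m) ⟨1, 1, by linear_combination htr⟩)
  obtain ⟨a, b, hab⟩ := hcop
  have h1 := isCMLattice_of_model ι hL a _ h
  have h2 := isCMLattice_of_model ι hL b _ (mul_conjPt_mem ι hL hβ' hπ₁)
  have e : ι (β' : K) * Ω - Ω / ι (π₁ : K) =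
      ι (a : K) * (ι ((π₀ ^ m : 𝓞 K) : K) * (ι (β' : K) * Ω - Ω / ι (π₁ : K))) +
        ι (b : K) * (ι (π₁ : K) * (ι (β' : K) * Ω - Ω / ι (π₁ : K))) := by
    have hab' : (a : K) * ((π₀ ^ m : 𝓞 K) : K) + (b : K) * (π₁ : K) = 1 := by exact_mod_cast congrArg (fun x : 𝓞 K => (x : K)) hab
    have hab'' := congrArg ι hab'
    rw [map_add, map_mul, map_mul, map_one] at hab''
    linear_combination -(ι (β' : K) * Ω - Ω / ι (π₁ : K)) * hab''
  rw [e]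
  exact add_mem h1 h2

end ConjPt

/-! ## §2 The translates `u′ = k·u_{N+1} + ū` -/

section Translates

/-- `c·z ∈ L` for `z ∈ L`, `c ∈ ℕ`. [folklore] -/
private theorem natMul_mem {z : ℂ} (h : z ∈ L.lattice) (c : ℕ) : (c : ℂ) * z ∈ L.lattice := by
  have := L.lattice.smul_mem (c : ℤ) h
  simpa [zsmul_eq_mul] using this

/-- `2^m·z ∈ L` for `z ∈ L`. [folklore] -/
private theorem twoPow_mul_mem {z : ℂ} (h : z ∈ L.lattice) (m : ℕ) : (2 : ℂ) ^ m * z ∈ L.lattice := by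
  simpa using natMul_mem h (2 ^ m)

/-- `(2 : ℂ)^m = ι(2^m)`. [folklore] -/
private theorem twoPow_eq_map (m : ℕ) : (2 : ℂ) ^ m = ι ((((2 : 𝓞 K) ^ m : 𝓞 K)) : K) := by
  have h : (ι.comp (algebraMap (𝓞 K) K)) ((2 : 𝓞 K) ^ m) = (2 : ℂ) ^ m := by rw [map_pow, map_ofNat]
  rw [← h, RingHom.comp_apply, ← RingOfIntegers.coe_eq_algebraMap]

include hL in
/-- `2^m·Ω ∈ L ↔ 2^m ∈ 𝔣`; so `2^m·Ω ∉ L` under `(𝔣, 2) = 1`. [cite: deShalit1987, II §4.2 (6)] -/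
theorem twoPow_mul_base_notMem (hΩ : Ω ≠ 0) (h𝔣 : ∀ m : ℕ, ((2 : 𝓞 K) ^ m : 𝓞 K) ∉ 𝔣) (m : ℕ) :
    (2 : ℂ) ^ m * Ω ∉ L.lattice := by
  rw [twoPow_eq_map ι, mul_comm, mul_mem_lattice_iff_of_model ι hL hΩ]
  exact h𝔣 m

include hL in
/-- `2^m·π₀·Ω ∉ L` under `(𝔣, 2) = 1`, `2 = π₀π₁` (`2^m π₀ ∈ 𝔣 ⟹ 2^{m+1} ∈ 𝔣`). [cite: deShalit1987, II §4.2 (6)] -/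
theorem twoPow_mul_gen_mul_base_notMem (hΩ : Ω ≠ 0) (h𝔣 : ∀ m : ℕ, ((2 : 𝓞 K) ^ m : 𝓞 K) ∉ 𝔣) (h2 : (2 : 𝓞 K) = π₀ * π₁) (m : ℕ) :
    (2 : ℂ) ^ m * (ι (π₀ : K) * Ω) ∉ L.lattice := by
  rw [twoPow_eq_map ι, ← mul_assoc, ← map_mul, mul_comm, show (((2 : 𝓞 K) ^ m : 𝓞 K) : K) * (π₀ : K) =
    ((((2 : 𝓞 K) ^ m * π₀ : 𝓞 K)) : K) by push_cast; ring, mul_mem_lattice_iff_of_model ι hL hΩ]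
  intro h
  apply h𝔣 (m + 1)
  have h1 : (2 : 𝓞 K) ^ m * π₀ * π₁ ∈ 𝔣 := 𝔣.mul_mem_right π₁ h
  rwa [mul_assoc, ← h2, ← pow_succ] at h1

variable {N k : ℕ}

include hL in
/-- `2^{N+2}·(k·u_{N+1} + ū) ∈ L` (`2^{N+1}u_{N+1} ∈ L`, `2ū ∈ L`). [cite: deShalit1987, II §4.4 (iv)] -/
theorem two_pow_mul_nsmul_divisionPt_add_conjPt_mem (hβ : β * π₀ - 1 ∈ 𝔣) (hπ₀ : π₀ ≠ 0) (hβ' : β' * π₁ - 1 ∈ 𝔣) (hπ₁ : π₁ ≠ 0)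
    (h2 : (2 : 𝓞 K) = π₀ * π₁) (N k : ℕ) :
    (2 : ℂ) ^ (N + 2) * ((k : ℂ) * (ι ((β ^ (N + 1) : 𝓞 K) : K) * Ω - Ω / ι ((π₀ ^ (N + 1) : 𝓞 K) : K)) +
      (ι (β' : K) * Ω - Ω / ι (π₁ : K))) ∈ L.lattice := by
  have h1 := natMul_mem (two_pow_mul_divisionPt_mem ι hL hβ hπ₀ h2 (N + 1)) (2 * k)
  have h2' := twoPow_mul_mem (two_mul_conjPt_mem ι hL hβ' hπ₁ h2) (N + 1)
  have e : (2 : ℂ) ^ (N + 2) * ((k : ℂ) * (ι ((β ^ (N + 1) : 𝓞 K) : K) * Ω - Ω / ι ((π₀ ^ (N + 1) : 𝓞 K) : K)) +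
      (ι (β' : K) * Ω - Ω / ι (π₁ : K))) =
      ((2 * k : ℕ) : ℂ) * ((2 : ℂ) ^ (N + 1) * (ι ((β ^ (N + 1) : 𝓞 K) : K) * Ω - Ω / ι ((π₀ ^ (N + 1) : 𝓞 K) : K))) +
        (2 : ℂ) ^ (N + 1) * (2 * (ι (β' : K) * Ω - Ω / ι (π₁ : K))) := by
    push_cast; ring
  rw [e]
  exact add_mem h1 h2'

include hL in
/-- `π₀^{N+1}·(k·u_{N+1} + ū) ∈ L ⟹ ū ∈ L` (`π₀^{N+1}` kills `u_{N+1}`; then `conjPt_mem_of_pow_mul_mem`). [cite: deShalit1987, II §4.4 (iv)] -/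
theorem conjPt_mem_of_pow_mul_nsmul_divisionPt_add_conjPt_mem (htr : π₀ + π₁ = 1) (hβ : β * π₀ - 1 ∈ 𝔣) (hπ₀ : π₀ ≠ 0)
    (hβ' : β' * π₁ - 1 ∈ 𝔣) (hπ₁ : π₁ ≠ 0)
    (h : ι ((π₀ ^ (N + 1) : 𝓞 K) : K) * ((k : ℂ) * (ι ((β ^ (N + 1) : 𝓞 K) : K) * Ω - Ω / ι ((π₀ ^ (N + 1) : 𝓞 K) : K)) +
      (ι (β' : K) * Ω - Ω / ι (π₁ : K))) ∈ L.lattice) :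
    ι (β' : K) * Ω - Ω / ι (π₁ : K) ∈ L.lattice := by
  have h1 := natMul_mem (pow_mul_divisionPt_mem ι hL hβ hπ₀ (N + 1)) k
  refine conjPt_mem_of_pow_mul_mem ι hL htr hβ' hπ₁ (N + 1) ?_
  have e : ι ((π₀ ^ (N + 1) : 𝓞 K) : K) * (ι (β' : K) * Ω - Ω / ι (π₁ : K)) =
      ι ((π₀ ^ (N + 1) : 𝓞 K) : K) * ((k : ℂ) * (ι ((β ^ (N + 1) : 𝓞 K) : K) * Ω - Ω / ι ((π₀ ^ (N + 1) : 𝓞 K) : K)) +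
        (ι (β' : K) * Ω - Ω / ι (π₁ : K))) -
      (k : ℂ) * (ι ((π₀ ^ (N + 1) : 𝓞 K) : K) * (ι ((β ^ (N + 1) : 𝓞 K) : K) * Ω - Ω / ι ((π₀ ^ (N + 1) : 𝓞 K) : K))) := by ring
  rw [e]
  exact sub_mem h h1

include hL in
/-- ★ **`k·u_{N+1} + ū ∉ L`** (`ū ∉ L`). [cite: deShalit1987, II §4.4 (iv)] -/
theorem nsmul_divisionPt_add_conjPt_notMem (hΩ : Ω ≠ 0) (htr : π₀ + π₁ = 1) (hβ : β * π₀ - 1 ∈ 𝔣) (hπ₀ : π₀ ≠ 0)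
    (hβ' : β' * π₁ - 1 ∈ 𝔣) (hπ₁ : π₁ ≠ 0) (hu : ¬ IsUnit π₁) :
    (k : ℂ) * (ι ((β ^ (N + 1) : 𝓞 K) : K) * Ω - Ω / ι ((π₀ ^ (N + 1) : 𝓞 K) : K)) + (ι (β' : K) * Ω - Ω / ι (π₁ : K)) ∉
      L.lattice := fun h =>
  conjPt_notMem ι hL hΩ hπ₁ hu
    (conjPt_mem_of_pow_mul_nsmul_divisionPt_add_conjPt_mem ι hL htr hβ hπ₀ hβ' hπ₁ (isCMLattice_of_model ι hL _ _ h))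

include hL in
/-- **`π₀·(k·u_{N+1} + ū) ∉ L`** (multiply by `π₀^N`). [cite: deShalit1987, II §4.4 (iv)] -/
theorem mul_nsmul_divisionPt_add_conjPt_notMem (hΩ : Ω ≠ 0) (htr : π₀ + π₁ = 1) (hβ : β * π₀ - 1 ∈ 𝔣) (hπ₀ : π₀ ≠ 0)
    (hβ' : β' * π₁ - 1 ∈ 𝔣) (hπ₁ : π₁ ≠ 0) (hu : ¬ IsUnit π₁) :
    ι (π₀ : K) * ((k : ℂ) * (ι ((β ^ (N + 1) : 𝓞 K) : K) * Ω - Ω / ι ((π₀ ^ (N + 1) : 𝓞 K) : K)) +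
      (ι (β' : K) * Ω - Ω / ι (π₁ : K))) ∉ L.lattice := by
  intro h
  refine conjPt_notMem ι hL hΩ hπ₁ hu (conjPt_mem_of_pow_mul_nsmul_divisionPt_add_conjPt_mem ι hL htr hβ hπ₀ hβ' hπ₁ (N := N) (k := k) ?_)
  have h1 := isCMLattice_of_model ι hL (π₀ ^ N) _ h
  have e : ι ((π₀ ^ (N + 1) : 𝓞 K) : K) * ((k : ℂ) * (ι ((β ^ (N + 1) : 𝓞 K) : K) * Ω - Ω / ι ((π₀ ^ (N + 1) : 𝓞 K) : K)) +
      (ι (β' : K) * Ω - Ω / ι (π₁ : K))) =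
      ι ((π₀ ^ N : 𝓞 K) : K) * (ι (π₀ : K) * ((k : ℂ) * (ι ((β ^ (N + 1) : 𝓞 K) : K) * Ω - Ω / ι ((π₀ ^ (N + 1) : 𝓞 K) : K)) +
        (ι (β' : K) * Ω - Ω / ι (π₁ : K)))) := by
    push_cast
    simp only [map_pow]
    ring
  rw [e]
  exact h1

include hL in
/-- **`Ω + (k·u_{N+1} + ū) ∉ L`** under `(𝔣, 2) = 1` (multiply by `2^{N+2}`). [cite: deShalit1987, II §4.4 (iv)] -/
theorem base_add_nsmul_divisionPt_add_conjPt_notMem (hΩ : Ω ≠ 0) (hβ : β * π₀ - 1 ∈ 𝔣) (hπ₀ : π₀ ≠ 0) (hβ' : β' * π₁ - 1 ∈ 𝔣)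
    (hπ₁ : π₁ ≠ 0) (h2 : (2 : 𝓞 K) = π₀ * π₁) (h𝔣 : ∀ m : ℕ, ((2 : 𝓞 K) ^ m : 𝓞 K) ∉ 𝔣) :
    Ω + ((k : ℂ) * (ι ((β ^ (N + 1) : 𝓞 K) : K) * Ω - Ω / ι ((π₀ ^ (N + 1) : 𝓞 K) : K)) + (ι (β' : K) * Ω - Ω / ι (π₁ : K))) ∉
      L.lattice := by
  intro h
  apply twoPow_mul_base_notMem ι hL hΩ h𝔣 (N + 2)
  have h1 := twoPow_mul_mem h (N + 2)
  have h2' := two_pow_mul_nsmul_divisionPt_add_conjPt_mem ι hL hβ hπ₀ hβ' hπ₁ h2 N k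
  have := sub_mem h1 h2'
  rwa [mul_add, add_sub_cancel_right] at this

include hL in
/-- **`π₀·(Ω + (k·u_{N+1} + ū)) ∉ L`** under `(𝔣, 2) = 1`, `2 = π₀π₁`. [cite: deShalit1987, II §4.4 (iv)] -/
theorem mul_base_add_nsmul_divisionPt_add_conjPt_notMem (hΩ : Ω ≠ 0) (hβ : β * π₀ - 1 ∈ 𝔣) (hπ₀ : π₀ ≠ 0) (hβ' : β' * π₁ - 1 ∈ 𝔣)
    (hπ₁ : π₁ ≠ 0) (h2 : (2 : 𝓞 K) = π₀ * π₁) (h𝔣 : ∀ m : ℕ, ((2 : 𝓞 K) ^ m : 𝓞 K) ∉ 𝔣) :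
    ι (π₀ : K) * (Ω + ((k : ℂ) * (ι ((β ^ (N + 1) : 𝓞 K) : K) * Ω - Ω / ι ((π₀ ^ (N + 1) : 𝓞 K) : K)) +
      (ι (β' : K) * Ω - Ω / ι (π₁ : K)))) ∉ L.lattice := by
  intro h
  apply twoPow_mul_gen_mul_base_notMem ι hL hΩ h𝔣 h2 (N + 2)
  have h1 := twoPow_mul_mem h (N + 2)
  have h2' := isCMLattice_of_model ι hL π₀ _ (two_pow_mul_nsmul_divisionPt_add_conjPt_mem ι hL hβ hπ₀ hβ' hπ₁ h2 N k)
  have := sub_mem h1 h2'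
  convert this using 1
  ring

include hL in
/-- ★ **The exclusion `π₀·(k·u_{N+1} + ū) + 2π₀Ω ∉ L`** under `(𝔣, 2) = 1`, `2 = π₀π₁` (multiply by `2^{N+2}`: `2^{N+3}π₀Ω ∈ L` would give
`2^{N+4} ∈ 𝔣`) — the hypothesis `hexcl` of `DivisionPointsLaneDescent`. [cite: deShalit1987, II §4.4 (iv)] -/
theorem mul_nsmul_divisionPt_add_conjPt_add_two_mul_notMem (hΩ : Ω ≠ 0) (hβ : β * π₀ - 1 ∈ 𝔣) (hπ₀ : π₀ ≠ 0)
    (hβ' : β' * π₁ - 1 ∈ 𝔣) (hπ₁ : π₁ ≠ 0) (h2 : (2 : 𝓞 K) = π₀ * π₁) (h𝔣 : ∀ m : ℕ, ((2 : 𝓞 K) ^ m : 𝓞 K) ∉ 𝔣) :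
    ι (π₀ : K) * ((k : ℂ) * (ι ((β ^ (N + 1) : 𝓞 K) : K) * Ω - Ω / ι ((π₀ ^ (N + 1) : 𝓞 K) : K)) +
        (ι (β' : K) * Ω - Ω / ι (π₁ : K))) + 2 * (ι (π₀ : K) * Ω) ∉ L.lattice := by
  intro h
  apply twoPow_mul_gen_mul_base_notMem ι hL hΩ h𝔣 h2 (N + 3)
  have h1 := twoPow_mul_mem h (N + 2)
  have h2' := isCMLattice_of_model ι hL π₀ _ (two_pow_mul_nsmul_divisionPt_add_conjPt_mem ι hL hβ hπ₀ hβ' hπ₁ h2 N k)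
  have := sub_mem h1 h2'
  convert this using 1
  ring

include hL in
/-- ★ **The congruence `π₀·(k·u_{N+2} + ū) − (k·u_{N+1} + ū) ∈ L`** (`π₀u_{N+2} ≡ u_{N+1}`, `π₀ū ≡ ū`). [cite: deShalit1987, II §4.4 (iv)] -/
theorem mul_nsmul_divisionPt_succ_add_conjPt_sub_mem (htr : π₀ + π₁ = 1) (hβ : β * π₀ - 1 ∈ 𝔣) (hπ₀ : π₀ ≠ 0)
    (hβ' : β' * π₁ - 1 ∈ 𝔣) (hπ₁ : π₁ ≠ 0) (N k : ℕ) :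
    ι (π₀ : K) * ((k : ℂ) * (ι ((β ^ (N + 2) : 𝓞 K) : K) * Ω - Ω / ι ((π₀ ^ (N + 2) : 𝓞 K) : K)) +
        (ι (β' : K) * Ω - Ω / ι (π₁ : K))) -
      ((k : ℂ) * (ι ((β ^ (N + 1) : 𝓞 K) : K) * Ω - Ω / ι ((π₀ ^ (N + 1) : 𝓞 K) : K)) + (ι (β' : K) * Ω - Ω / ι (π₁ : K))) ∈
      L.lattice := by
  have h1 := natMul_mem (mul_divisionPt_succ_sub_mem ι hL hβ hπ₀ (N + 1)) k
  have h2' := mul_conjPt_sub_conjPt_mem ι hL htr hβ' hπ₁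
  convert add_mem h1 h2' using 1
  ring

include hL in
/-- **`π₀·(k·u₁ + ū) − ū ∈ L`** (`π₀u₁ ∈ L`, `π₀ū ≡ ū`): at the bottom level the descent lands on `ū` — the hypothesis `h₀` side.
[cite: deShalit1987, II §4.4 (iv)] -/
theorem mul_nsmul_divisionPt_one_add_conjPt_sub_conjPt_mem (htr : π₀ + π₁ = 1) (hβ : β * π₀ - 1 ∈ 𝔣) (hπ₀ : π₀ ≠ 0)
    (hβ' : β' * π₁ - 1 ∈ 𝔣) (hπ₁ : π₁ ≠ 0) (k : ℕ) :
    ι (π₀ : K) * ((k : ℂ) * (ι ((β ^ (0 + 1) : 𝓞 K) : K) * Ω - Ω / ι ((π₀ ^ (0 + 1) : 𝓞 K) : K)) +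
        (ι (β' : K) * Ω - Ω / ι (π₁ : K))) - (ι (β' : K) * Ω - Ω / ι (π₁ : K)) ∈ L.lattice := by
  have h1 := natMul_mem (pow_mul_divisionPt_mem ι hL hβ hπ₀ (0 + 1)) k
  have h2' := mul_conjPt_sub_conjPt_mem ι hL htr hβ' hπ₁
  convert add_mem h1 h2' using 1
  push_cast
  ring

end Translates

end Literature.NumberTheory.ComplexMultiplication.EllipticUnits

end
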